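import Mathlib
import Summits.NavierStokesRegularity.NavierStokesRegularity.Theorems.EulerZoomLiouvillePowerGaugeEulerLiouvilleSelfSimilarKelvinFlowC2

/-!
# THE HEIGHT LEDGER — `e^{γσ}⟪Ψ_σ y, e⟫` changes exactly by `−∫ e^{γs}⟪V(Ψ_s y), e⟫ ds`; EXIT = MOMENTUM OR IMPULSE
# (plate t44-H, nsreg-p2 g33; ROUND-43 «THE SWIRL TAX» §2, THEOREM C)

Width piece for crux `EulerZoomLiouville.PowerGaugeEulerLiouville` (stmt-NavierStokesRegularity-19832), `--supports … --as helper`.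
Backward similarity flow `Ψ_σ y = Φ_{−σ} y` of `W = γy + V` (`Ψ' = −W(Ψ)`), `V ∈ C¹` with bounded derivative; pure ODE kinematics:

* (H1) `hasDerivAt_exp_mul_inner_flow_neg` — `d/dσ (e^{γσ}⟪Ψ_σ y, e⟫) = −e^{γσ}⟪V(Ψ_σ y), e⟫` (the similarity drift `γy` is absorbed by the weight);
* (H2) `exp_mul_inner_flow_sub_eq` — `e^{γS}⟪Ψ_S y, e⟫ − ⟪y, e⟫ = −∫₀^S e^{γs}⟪V(Ψ_s y), e⟫ ds`;
* (H3) `inner_flow_le_of_momentum_bound` — if `|⟪V(Ψ_s y), e⟫| ≤ e^{(1−γ)s}·M` on `[0,S]` (the shape delivered by the MOMENTUM LEDGER t43-D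
  `Condenser.abs_inner_velocity_le_of_pressure_bound`, `M = |⟪U y, e⟫| + B·S`, `B` = a bound for `|⟪∇P, e⟫|` along the orbit piece) then
  `⟪Ψ_S y, e⟫ ≤ e^{−γS}⟪y, e⟫ + e^{(1−γ)S}·M`;
* (H4) `mul_exp_le_of_exit` — **EXIT = MOMENTUM OR IMPULSE**: if moreover `0 ≤ γ`, `⟪y, e⟫ ≤ R`, `0 ≤ R` and `2R ≤ ⟪Ψ_S y, e⟫`, then `R·e^{−(1−γ)S} ≤ M`.

READING (ROUND-43 THEOREM C): composed with t43-D, a backward orbit of the PROFILE flow from `B(0,R)` reaching `⟪·,e⟫ = 2R` at time `σ★` satisfies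
`R e^{−(1−γ)σ★} ≤ |⟪U(y),e⟫| + σ★ · sup_orbit |⟪∇P,e⟫|`: a FAST exit of a NON-anomalous label is PRESSURE-DRIVEN.  HONEST FRAME: kinematics; 19832 OPEN;
not NS, not E. [folklore]
-/

noncomputable section

set_option linter.dupNamespace false

open Set Metric MeasureTheory intervalIntegral InnerProductSpace
open scoped RealInnerProductSpace

namespace Summit.NavierStokesRegularity.NavierStokesRegularity.Theorems.PowerGaugeEulerLiouville.Condenser

open Literature.Analysis Literature.Analysis.FluidPDE
open Summit.NavierStokesRegularity.NavierStokesRegularity.Theorems.PowerGaugeEulerLiouville.C2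

variable {γ : ℝ} {V : (EuclideanSpace ℝ (Fin 3)) → (EuclideanSpace ℝ (Fin 3))}

/-- **(H1)** `d/dσ (e^{γσ}⟪Ψ_σ y, e⟫) = −e^{γσ}⟪V(Ψ_σ y), e⟫`. [folklore] -/
theorem hasDerivAt_exp_mul_inner_flow_neg (hV : ContDiff ℝ 1 V) {K : ℝ} (hK : ∀ y, ‖fderiv ℝ V y‖ ≤ K)
    (y e : EuclideanSpace ℝ (Fin 3)) (σ : ℝ) :
    HasDerivAt (fun s => Real.exp (γ * s) * ⟪ODE.evolutionMap (fun _ : ℝ => selfSimilarTransport γ 0 V) 0 (-s) y, e⟫)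
      (-(Real.exp (γ * σ) * ⟪V (ODE.evolutionMap (fun _ : ℝ => selfSimilarTransport γ 0 V) 0 (-σ) y), e⟫)) σ := by
  have ha := (Kelvin.hasDerivAt_flow_neg (γ := γ) hV hK y σ).inner ℝ (hasDerivAt_const σ e)
  simp only [inner_zero_right, zero_add, real_inner_smul_left, neg_mul, one_mul] at ha
  have hexp : HasDerivAt (fun s : ℝ => Real.exp (γ * s)) (Real.exp (γ * σ) * γ) σ := by
    have h1 : HasDerivAt (fun s : ℝ => γ * s) (γ * 1) σ := (hasDerivAt_id' σ).const_mul γ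
    have h2 := h1.exp
    simpa [mul_one] using h2
  have h := hexp.mul ha
  refine h.congr_deriv ?_
  rw [selfSimilarTransport_apply, sub_zero, inner_add_left, real_inner_smul_left]
  ring

/-- **(H2)** `e^{γS}⟪Ψ_S y, e⟫ − ⟪y, e⟫ = −∫₀^S e^{γs}⟪V(Ψ_s y), e⟫ ds` (oriented interval integral, any `S`). [folklore] -/
theorem exp_mul_inner_flow_sub_eq (hV : ContDiff ℝ 1 V) {K : ℝ} (hK : ∀ y, ‖fderiv ℝ V y‖ ≤ K)
    (y e : EuclideanSpace ℝ (Fin 3)) (S : ℝ) :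
    Real.exp (γ * S) * ⟪ODE.evolutionMap (fun _ : ℝ => selfSimilarTransport γ 0 V) 0 (-S) y, e⟫ - ⟪y, e⟫ =
      -∫ s in (0 : ℝ)..S, Real.exp (γ * s) * ⟪V (ODE.evolutionMap (fun _ : ℝ => selfSimilarTransport γ 0 V) 0 (-s) y), e⟫ := by
  have hcont : Continuous fun s : ℝ =>
      Real.exp (γ * s) * ⟪V (ODE.evolutionMap (fun _ : ℝ => selfSimilarTransport γ 0 V) 0 (-s) y), e⟫ := by
    have hΨ : Continuous fun s : ℝ => ODE.evolutionMap (fun _ : ℝ => selfSimilarTransport γ 0 V) 0 (-s) y :=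
      (Kelvin.continuous_flow_apply (γ := γ) hV hK y).comp continuous_neg
    exact (Real.continuous_exp.comp (continuous_const.mul continuous_id)).mul
      (((hV.continuous.comp hΨ).inner continuous_const))
  have hftc := integral_eq_sub_of_hasDerivAt (a := 0) (b := S)
    (fun s _ => hasDerivAt_exp_mul_inner_flow_neg hV hK y e s) (hcont.neg.intervalIntegrable _ _)
  rw [intervalIntegral.integral_neg] at hftc
  have h0 : Real.exp (γ * 0) * ⟪ODE.evolutionMap (fun _ : ℝ => selfSimilarTransport γ 0 V) 0 (-0) y, e⟫ = ⟪y, e⟫ := by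
    simp [ODE.evolutionMap_self]
  rw [h0] at hftc
  linarith

/-- **(H3)** A momentum bound of the damped-exponential shape `|⟪V(Ψ_s y), e⟫| ≤ e^{(1−γ)s} M` on `[0,S]` bounds the height:
`⟪Ψ_S y, e⟫ ≤ e^{−γS}⟪y, e⟫ + e^{(1−γ)S} M`. [folklore] -/
theorem inner_flow_le_of_momentum_bound (hV : ContDiff ℝ 1 V) {K : ℝ} (hK : ∀ y, ‖fderiv ℝ V y‖ ≤ K)
    (y e : EuclideanSpace ℝ (Fin 3)) {S : ℝ} (hS : 0 ≤ S) {M : ℝ}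
    (hM : ∀ s ∈ Icc (0 : ℝ) S,
      |⟪V (ODE.evolutionMap (fun _ : ℝ => selfSimilarTransport γ 0 V) 0 (-s) y), e⟫| ≤ Real.exp ((1 - γ) * s) * M) :
    ⟪ODE.evolutionMap (fun _ : ℝ => selfSimilarTransport γ 0 V) 0 (-S) y, e⟫ ≤
      Real.exp (-(γ * S)) * ⟪y, e⟫ + Real.exp ((1 - γ) * S) * M := by
  have hM0 : 0 ≤ M := by
    have h := hM 0 ⟨le_rfl, hS⟩
    simp only [mul_zero, Real.exp_zero, one_mul] at h
    exact (abs_nonneg _).trans h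
  have hΨ : Continuous fun s : ℝ => ODE.evolutionMap (fun _ : ℝ => selfSimilarTransport γ 0 V) 0 (-s) y :=
    (Kelvin.continuous_flow_apply (γ := γ) hV hK y).comp continuous_neg
  have hc1 : Continuous fun s : ℝ =>
      Real.exp (γ * s) * ⟪V (ODE.evolutionMap (fun _ : ℝ => selfSimilarTransport γ 0 V) 0 (-s) y), e⟫ :=
    (Real.continuous_exp.comp (continuous_const.mul continuous_id)).mul ((hV.continuous.comp hΨ).inner continuous_const)
  -- pointwise: `−e^{γs}⟪V,e⟫ ≤ e^{s} M`
  have hpt : ∀ s ∈ Icc (0 : ℝ) S,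
      -(Real.exp (γ * s) * ⟪V (ODE.evolutionMap (fun _ : ℝ => selfSimilarTransport γ 0 V) 0 (-s) y), e⟫) ≤ Real.exp s * M := by
    intro s hs
    have hexp0 : 0 < Real.exp (γ * s) := Real.exp_pos _
    have hv : 0 ≤ ⟪V (ODE.evolutionMap (fun _ : ℝ => selfSimilarTransport γ 0 V) 0 (-s) y), e⟫ +
        Real.exp ((1 - γ) * s) * M := by linarith [(abs_le.mp (hM s hs)).1]
    have hprod : Real.exp (γ * s) * (Real.exp ((1 - γ) * s) * M) = Real.exp s * M := by
      rw [← mul_assoc, ← Real.exp_add]; ring_nf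
    have h := mul_nonneg hexp0.le hv
    rw [mul_add, hprod] at h
    linarith
  -- integrate: `−∫ f ≤ (e^S − 1) M ≤ e^S M`
  have hI2 : -(∫ s in (0 : ℝ)..S, Real.exp (γ * s) *
      ⟪V (ODE.evolutionMap (fun _ : ℝ => selfSimilarTransport γ 0 V) 0 (-s) y), e⟫) ≤ Real.exp S * M := by
    rw [← intervalIntegral.integral_neg]
    calc ∫ s in (0 : ℝ)..S, -(Real.exp (γ * s) *
          ⟪V (ODE.evolutionMap (fun _ : ℝ => selfSimilarTransport γ 0 V) 0 (-s) y), e⟫)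
        ≤ ∫ s in (0 : ℝ)..S, Real.exp s * M :=
          intervalIntegral.integral_mono_on hS (hc1.neg.intervalIntegrable _ _)
            ((Real.continuous_exp.mul continuous_const).intervalIntegrable _ _) hpt
      _ = (Real.exp S - 1) * M := by rw [intervalIntegral.integral_mul_const, integral_exp, Real.exp_zero]
      _ ≤ Real.exp S * M := by nlinarith [hM0]
  have hid := exp_mul_inner_flow_sub_eq (γ := γ) hV hK y e S
  have h2 : Real.exp (γ * S) * ⟪ODE.evolutionMap (fun _ : ℝ => selfSimilarTransport γ 0 V) 0 (-S) y, e⟫ ≤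
      ⟪y, e⟫ + Real.exp S * M := by linarith [hid, hI2]
  -- multiply by `e^{−γS} > 0`
  have hpos : 0 < Real.exp (-(γ * S)) := Real.exp_pos _
  have h3 := mul_le_mul_of_nonneg_left h2 hpos.le
  have e1 : Real.exp (-(γ * S)) * (Real.exp (γ * S) *
      ⟪ODE.evolutionMap (fun _ : ℝ => selfSimilarTransport γ 0 V) 0 (-S) y, e⟫) =
      ⟪ODE.evolutionMap (fun _ : ℝ => selfSimilarTransport γ 0 V) 0 (-S) y, e⟫ := by
    rw [← mul_assoc, ← Real.exp_add, neg_add_cancel, Real.exp_zero, one_mul]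
  have e2 : Real.exp (-(γ * S)) * (⟪y, e⟫ + Real.exp S * M) =
      Real.exp (-(γ * S)) * ⟪y, e⟫ + Real.exp ((1 - γ) * S) * M := by
    rw [mul_add, ← mul_assoc, ← Real.exp_add]; ring_nf
  rw [e1, e2] at h3
  exact h3

/-- **(H4) EXIT = MOMENTUM OR IMPULSE.**  If `0 ≤ γ`, the label starts at height `⟪y, e⟫ ≤ R` (`0 ≤ R`), the momentum bound of (H3) holds on `[0,S]`
and the orbit reaches height `2R` at time `S`, then `R e^{−(1−γ)S} ≤ M`. [folklore] -/
theorem mul_exp_le_of_exit (hV : ContDiff ℝ 1 V) {K : ℝ} (hK : ∀ y, ‖fderiv ℝ V y‖ ≤ K) (hγ : 0 ≤ γ)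
    (y e : EuclideanSpace ℝ (Fin 3)) {S : ℝ} (hS : 0 ≤ S) {M : ℝ}
    (hM : ∀ s ∈ Icc (0 : ℝ) S,
      |⟪V (ODE.evolutionMap (fun _ : ℝ => selfSimilarTransport γ 0 V) 0 (-s) y), e⟫| ≤ Real.exp ((1 - γ) * s) * M)
    {R : ℝ} (hR : 0 ≤ R) (hy : ⟪y, e⟫ ≤ R)
    (hexit : 2 * R ≤ ⟪ODE.evolutionMap (fun _ : ℝ => selfSimilarTransport γ 0 V) 0 (-S) y, e⟫) :
    R * Real.exp (-((1 - γ) * S)) ≤ M := by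
  have h3 := inner_flow_le_of_momentum_bound hV hK y e hS hM
  have hexp1 : Real.exp (-(γ * S)) ≤ 1 := by
    rw [Real.exp_le_one_iff]; nlinarith
  have hexp0 : 0 < Real.exp (-(γ * S)) := Real.exp_pos _
  -- `e^{−γS}⟪y,e⟫ ≤ R`
  have hfirst : Real.exp (-(γ * S)) * ⟪y, e⟫ ≤ R := by
    rcases le_or_gt 0 ⟪y, e⟫ with hpos | hneg
    · calc Real.exp (-(γ * S)) * ⟪y, e⟫ ≤ 1 * ⟪y, e⟫ := mul_le_mul_of_nonneg_right hexp1 hpos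
        _ ≤ R := by rw [one_mul]; exact hy
    · have : Real.exp (-(γ * S)) * ⟪y, e⟫ ≤ 0 := mul_nonpos_of_nonneg_of_nonpos hexp0.le hneg.le
      linarith
  have h4 : R ≤ Real.exp ((1 - γ) * S) * M := by linarith
  have hE : 0 < Real.exp ((1 - γ) * S) := Real.exp_pos _
  have hEinv : Real.exp (-((1 - γ) * S)) * Real.exp ((1 - γ) * S) = 1 := by
    rw [← Real.exp_add, neg_add_cancel, Real.exp_zero]
  calc R * Real.exp (-((1 - γ) * S))
      ≤ Real.exp ((1 - γ) * S) * M * Real.exp (-((1 - γ) * S)) :=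
        mul_le_mul_of_nonneg_right h4 (Real.exp_pos _).le
    _ = M := by rw [mul_comm (Real.exp _) M, mul_assoc, mul_comm (Real.exp ((1 - γ) * S)), hEinv, mul_one]

end Summit.NavierStokesRegularity.NavierStokesRegularity.Theorems.PowerGaugeEulerLiouville.Condenser
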